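import Summits.RiemannHypothesis.RiemannHypothesis.Theorems.WeilFormatCCinfDoorPoly
import Summits.RiemannHypothesis.RiemannHypothesis.Theorems.WeilFormatCFarDiagPos
import HarnessLib

/-!
# Format C, design C∞: the far-diagonal FLOORS of the front door from a middle-range table and one far value

Route context: Fourier–Galerkin / Schur-complement certificates of Weil positivity on a window ("format C", C∞ door;
cell memo `run/shared/lean/pub/rh-explicit/rh-explicit-weil-10/KERNEL-LEVER.md` §22; supporting stmt-RiemannHypothesis-0098;
seat rh-explicit-weil-10).  `weilPositivityOn_of_cinf_poly` / `weilPositivityOn_of_cinf_matrix` take a far diagonal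
`d̂ : ℕ → ℝ` with a floor `d₀` on `[B+1, ∞)`, a floor `d₁` on `[m₀, ∞)` and `d̂ ≤ d̂_A` (`hde₀ hde hde₁ hde₃ hdle`, odd alike),
and `WeilFormatCCinfMiddleForm` wants per-mode weights `0 < w_m ≤ d̂(m)` on `[B+1, m₀)`.  The natural data are a per-mode
TABLE `wtab` on the middle range (checked against `d̂_A(m)` mode by mode, as the format-C column weights) and ONE value
`d₁` checked at `m₀` — beyond `m₀` the analytic diagonal is monotone (`even_dhat_core_mono`; odd: monotone core minus the
arctan penalty `≤ π/4`, `odd_dhat_core_mono`, `hilbert_atan_penalty_le`).  With `d̂ := fun m ↦ if m < m₀ then wtab m else d₁`: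

* `cinf_de_lo`, `cinf_de_hi`, `cinf_de_weights` — the floors and the middle-range weights (generic);
* `cinf_hdle_even`, `cinf_hdle_odd` — `d̂ ≤ d̂_A` on `[B+1, ∞)` (resp. `[Bo, ∞)`) from the table checks and the one far check.

Elementary; standard axioms; no definitions; no RH claim.
-/

set_option autoImplicit false
-- `Summit.RiemannHypothesis.RiemannHypothesis.…` is the layout-mandated namespace (summit = problem name).
set_option linter.dupNamespace false

noncomputable section

open Finset
open scoped Real ArithmeticFunction.vonMangoldt

namespace Summit.RiemannHypothesis.RiemannHypothesis.Theorems.WeilFormatC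

open Literature.NumberTheory.LFunctions Literature.NumberTheory.LFunctions.Yoshida1992
open Literature.Analysis.SpecialFunctions

variable {a : ℝ}

/-! ## Generic: floors and weights of a two-piece diagonal -/

/-- Lower floor on `[B, ∞)`: if `d₀ ≤ wtab m` on `[B, m₀)` and `d₀ ≤ d₁`, then `d₀ ≤ d̂(m)` for `m ≥ B`. -/
theorem cinf_de_lo {B m₀ : ℕ} (wtab : ℕ → ℝ) {d₀ d₁ : ℝ}
    (htab : ∀ m, B ≤ m → m < m₀ → d₀ ≤ wtab m) (h01 : d₀ ≤ d₁) :
    ∀ m : ℕ, B ≤ m → d₀ ≤ (if m < m₀ then wtab m else d₁) := by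
  intro m hm
  by_cases h : m < m₀
  · rw [if_pos h]; exact htab m hm h
  · rw [if_neg h]; exact h01

/-- Far floor on `[m₀, ∞)`: `d₁ ≤ d̂(m)` for `m ≥ m₀` (it IS `d₁` there). -/
theorem cinf_de_hi {m₀ : ℕ} (wtab : ℕ → ℝ) (d₁ : ℝ) :
    ∀ m : ℕ, m₀ ≤ m → d₁ ≤ (if m < m₀ then wtab m else d₁) := by
  intro m hm
  rw [if_neg (by omega)]

/-- Middle-range weights for `WeilFormatCCinfMiddleForm`: take `w := d̂` itself (`0 < d₀ ≤ wtab m` on `[B, m₀)`). -/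
theorem cinf_de_weights {B m₀ : ℕ} (wtab : ℕ → ℝ) {d₀ : ℝ} (d₁ : ℝ) (hd₀ : 0 < d₀)
    (htab : ∀ m, B ≤ m → m < m₀ → d₀ ≤ wtab m) :
    ∀ m ∈ Finset.Ico B m₀, 0 < (if m < m₀ then wtab m else d₁)
      ∧ (if m < m₀ then wtab m else d₁) ≤ (if m < m₀ then wtab m else d₁) := by
  intro m hm
  rw [Finset.mem_Ico] at hm
  rw [if_pos hm.2]
  exact ⟨hd₀.trans_le (htab m hm.1 hm.2), le_rfl⟩

/-! ## `d̂ ≤ d̂_A` from the table and one far value -/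

/-- **Even sector**: `d̂ ≤ d̂_A` on `[Be+1, ∞)` for `d̂ := fun m ↦ if m < m₀e then wtab m else d₁e`, from the per-mode
table checks on `[Be+1, m₀e)` and the single check `d₁e ≤ d̂_A(m₀e)` (monotone beyond). -/
theorem cinf_hdle_even (ha : 0 < a) (A : ℝ) {Be m₀e : ℕ} (hBme : Be < m₀e) (wtab : ℕ → ℝ) (d₁e : ℝ)
    (htab : ∀ m : ℕ, Be + 1 ≤ m → m < m₀e → wtab m ≤
      (reDigammaQuarter (freq a m) - Real.log π) / 2 - a * (1 + weilArchDensity (2 * a)) / (π ^ 2 * m ^ 2)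
        - 1 / (8 * m) - a * (1 + weilArchDensity (2 * a)) / π ^ 2 * Real.sqrt (8 / ((Be + 1 - 1 : ℕ) : ℝ)) - A / 2)
    (hd₁ : d₁e ≤
      (reDigammaQuarter (freq a m₀e) - Real.log π) / 2 - a * (1 + weilArchDensity (2 * a)) / (π ^ 2 * m₀e ^ 2)
        - 1 / (8 * m₀e) - a * (1 + weilArchDensity (2 * a)) / π ^ 2 * Real.sqrt (8 / ((Be + 1 - 1 : ℕ) : ℝ)) - A / 2) :
    ∀ m : ℕ, Be + 1 ≤ m → (if m < m₀e then wtab m else d₁e) ≤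
      (reDigammaQuarter (freq a m) - Real.log π) / 2 - a * (1 + weilArchDensity (2 * a)) / (π ^ 2 * m ^ 2)
        - 1 / (8 * m) - a * (1 + weilArchDensity (2 * a)) / π ^ 2 * Real.sqrt (8 / ((Be + 1 - 1 : ℕ) : ℝ)) - A / 2 := by
  intro m hm
  by_cases h : m < m₀e
  · rw [if_pos h]; exact htab m hm h
  · rw [if_neg h]
    have hC : 0 ≤ a * (1 + weilArchDensity (2 * a)) := by
      have := weilArchDensity_pos (t := 2 * a) (by positivity)
      positivity
    have hmono := even_dhat_core_mono ha hC (B := m₀e) (m := m) (by omega) (by omega)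
    linarith

/-- **Odd sector**: `d̂ ≤ d̂_A` on `[Bo, ∞)` (kernel indices `k`, modes `k+1`) for
`d̂ := fun k ↦ if k < m₀o then wtab k else d₁o`, from the per-mode table checks on `[Bo, m₀o)` (arctan weight exact)
and the single check `d₁o ≤ core(m₀o) − π/4 − constants` (monotone core, arctan penalty `≤ π/4` beyond). -/
theorem cinf_hdle_odd (ha : 0 < a) (A : ℝ) {Bo m₀o : ℕ} (wtab : ℕ → ℝ) (d₁o : ℝ)
    (htab : ∀ k : ℕ, Bo ≤ k → k < m₀o → wtab k ≤
      (reDigammaQuarter (freq a ((k : ℤ) + 1)) - Real.log π) / 2 - 1 / (8 * ((k : ℝ) + 1))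
        - a * (1 + weilArchDensity (2 * a)) / (π ^ 2 * ((k : ℝ) + 1) ^ 2)
        - (π / 2 - Real.arctan (Real.sqrt Bo / Real.sqrt ((k : ℝ) + 1))) / 2
        - a * (1 + weilArchDensity (2 * a)) / π ^ 2 * Real.sqrt (8 / Bo)
        - A / 2
        - (Real.exp (a / 2) - Real.exp (-(a / 2))) ^ 2 * a / (π ^ 2 * Bo))
    (hd₁ : d₁o ≤
      (reDigammaQuarter (freq a ((m₀o : ℤ) + 1)) - Real.log π) / 2 - 1 / (8 * ((m₀o : ℝ) + 1))
        - a * (1 + weilArchDensity (2 * a)) / (π ^ 2 * ((m₀o : ℝ) + 1) ^ 2)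
        - π / 4
        - a * (1 + weilArchDensity (2 * a)) / π ^ 2 * Real.sqrt (8 / Bo)
        - A / 2
        - (Real.exp (a / 2) - Real.exp (-(a / 2))) ^ 2 * a / (π ^ 2 * Bo)) :
    ∀ k : ℕ, Bo ≤ k → (if k < m₀o then wtab k else d₁o) ≤
      (reDigammaQuarter (freq a ((k : ℤ) + 1)) - Real.log π) / 2 - 1 / (8 * ((k : ℝ) + 1))
        - a * (1 + weilArchDensity (2 * a)) / (π ^ 2 * ((k : ℝ) + 1) ^ 2)
        - (π / 2 - Real.arctan (Real.sqrt Bo / Real.sqrt ((k : ℝ) + 1))) / 2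
        - a * (1 + weilArchDensity (2 * a)) / π ^ 2 * Real.sqrt (8 / Bo)
        - A / 2
        - (Real.exp (a / 2) - Real.exp (-(a / 2))) ^ 2 * a / (π ^ 2 * Bo) := by
  intro k hk
  by_cases h : k < m₀o
  · rw [if_pos h]; exact htab k hk h
  · rw [if_neg h]
    have hC : 0 ≤ a * (1 + weilArchDensity (2 * a)) := by
      have := weilArchDensity_pos (t := 2 * a) (by positivity)
      positivity
    have hmono := odd_dhat_core_mono ha hC (B := m₀o) (k := k) (by omega)
    have hpen := hilbert_atan_penalty_le Bo k
    linarith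

end Summit.RiemannHypothesis.RiemannHypothesis.Theorems.WeilFormatC

end
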